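import Literature.NumberTheory.GaloisRepresentations.WeilLAdicCharacterLocalShape
import Literature.NumberTheory.NumberFields.IdelicArtinMap
import Literature.NumberTheory.EllipticCurves.DeShalit1987.LMeasureAvatarRigidity
import HarnessLib

/-!
# The value of a `p`-adic avatar at a GLOBAL element of `Γ_K`: `r(σ) = ψ_p(x)⁻¹` whenever
# `σ|_{K^ab} = [x, K]` — the idelic character WITH its global clause, and the consequence for
# Weil's avatar and for ANY avatar of an algebraic Hecke character

Topic `NumberTheory/GaloisRepresentations`; namespaces `Literature.NumberTheory.GaloisRepresentations`
(§1–§2) and `Literature.NumberTheory.EllipticCurves` (§3). A *proofs* file: theorems only, no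
definition, no named fact, no instance.

The tree attaches to a continuous abelian character `ψ : Γ_K → GL₁(A)` its idele class character
`Ψ = ψ^ab ∘ ( , K)` (`FramedGaloisRep.exists_idelicCharacter`, `…_localGlobal`) and records
(i) `Ψ(Kˣ) = 1`, (ii) its shape at the unramified places, (iii) local–global compatibility at every
place for LOCAL Weil elements. What the producer of de Shalit's measure (II Thm. 4.14 in measure
currency, `DeShalit1987.IsLMeasure`: integrals of `σ ↦ ε̂(σ)` over GLOBAL `σ ∈ Γ_K`) needs and the
tree did not export is the GLOBAL clause

  (iv) `σ|_{K^ab} = [x, K]` (`absGaloisAbProj K σ = ideleArtinMap K x`) ⟹ `Ψ x = det ψ σ`,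

which holds by construction (`Ψ := ψ^ab ∘ [·, K]` with Shimura's `[·, K] = ideleArtinMap K`). This file:

* §1 `FramedGaloisRep.exists_idelicCharacter_global` — `Ψ` with (i), (ii) AND (iv).
* §2 `HeckeCharacter.HasInfinityType.det_weilRep_eq_lAdicAvatar_inv` — for Weil's avatar
  `r = hinf.weilRep hmod ι` of a Hecke character `χ` of type `(p, q)`:
  **`det r σ = ψ_p(x)⁻¹`** whenever `σ|_{K^ab} = [x, K]`, `ψ_p = hinf.lAdicAvatar ι` Weil's `p`-adic
  avatar ON IDELES (`Ψ_r = ψ_p⁻¹`, the tree's `eq_lAdicAvatar_inv`).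
* §3 `IsPAdicAvatarOf.eq_weilRep` (ANY avatar in the tree's Frobenius sense IS Weil's — avatar
  rigidity `IsPAdicAvatarOutside.eq_of_isPAdicAvatarOf`, Chebotarev in the tree),
  ★ `IsPAdicAvatarOf.det_eq_lAdicAvatarHom_inv` and ★ `IsPAdicAvatarOf.avatarValueAt_eq`:
  for any avatar `r` of `φ` of type `(pp, qq)` and `σ|_{K^ab} = [x, K]`,
  **`avatarValueAt r σ = (ψ_p(x)⁻¹ : ℚ̄_p) ∈ ℂ_p`**, `ψ_p = lAdicAvatarHom φ ι pp qq`
  (`= ι⁻¹(φ(x) A(x_∞)⁻¹) · ∏_{(w,e) : w ∣ p} e(x_w)^{−n_{(w,e)}}`, `coe_lAdicAvatarHom_apply`).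

With `[·, K]` onto `Γ_K^ab` (`ideleArtinMap_surjective`) every `σ` has such an `x`; for
`σ ∈ Gal(K̄/K(𝔪))` one may take `x ∈ W_𝔪` (units everywhere, `≡ 1 (mod 𝔪)`), whose `v`-component is
the ray adic character `rayAdicCharacter` of `RayClassFieldAdicCharacter.lean` — the form in which
de Shalit II.4.13–4.14 reads `ε̂ = κ^k λ^{-j} χ` on `𝒢 = Gal(K(𝔣p^∞)/K)` (sequel files).

## References
* [SerreAbelianLadic1968] J.-P. Serre, *Abelian ℓ-adic representations and elliptic curves* (1968),
  Ch. II §2.7 (the character `ψ_ℓ` attached to an algebraic Hecke character), Ch. III §2.1–2.3.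
* [NeukirchANT1999] J. Neukirch, *Algebraic Number Theory* (1999), Ch. VI §5 (5.6), §6 Thm. (6.1).
* [deShalit1987] E. de Shalit, *Iwasawa theory of elliptic curves with complex multiplication* (1987),
  II.4.13 (p. 69), II.4.14 (36) (p. 71–73) — the consumer.
* [Weil1956] A. Weil, *On a certain type of characters of the idèle-class group of an algebraic
  number-field* (1956), §1–§2.
-/

noncomputable section

open scoped NumberField Polynomial Topology
open NumberField IsDedekindDomain IsDedekindDomain.HeightOneSpectrum Field Polynomial Filter

namespace Literature.NumberTheory.GaloisRepresentations

open Literature.NumberTheory.NumberFields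

variable {K : Type} [Field K] [NumberField K]
variable {A : Type*} [NormedField A] [IsUltrametricDist A]

/-! ### §1. The idelic character with its GLOBAL clause -/

/-- `f⁻¹ x = (f x)⁻¹` for continuous monoid homs into a commutative group (definitional). [folklore] -/
private theorem cmh_inv_apply'' {G H : Type*} [Monoid G] [TopologicalSpace G] [CommGroup H]
    [TopologicalSpace H] [IsTopologicalGroup H] (f : G →ₜ* H) (x : G) : f⁻¹ x = (f x)⁻¹ := rfl

open ArtinLocalGlobal in
/-- **The idele class character `Ψ = ψ^ab ∘ [·, K]` of an abelian character `ψ : Γ_K → GL₁(A)`, WITH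
ITS GLOBAL CLAUSE.** There is a continuous `Ψ : 𝕀_K →ₜ* Aˣ` with (i) `Ψ(Kˣ) = 1`; (ii) at every place
`v` where `ψ` is unramified, `Ψ(⟨𝒪_vˣ⟩_v) = 1` and `ψ(Frob_v)` has characteristic polynomial
`X − Ψ(⟨ϖ⟩_v)` for every `ϖ` of valuation one (the clauses of `FramedGaloisRep.exists_idelicCharacter`);
and (iv) **for every `σ ∈ Γ_K` and idele `x` with `σ|_{K^ab} = [x, K]`, `Ψ x = det ψ σ`.** Proof:
`det ψ` kills the closed commutator subgroup, so factors as `ψ^ab : Γ_K^ab → Aˣ`; put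
`Ψ := ψ^ab ∘ ideleArtinMap K` — (iv) is then definitional, (i) is `[Kˣ, K] = 1`, and (ii) is the
tree's finite-level Frobenius/inertia computation (`artinIdeleMap_localUnits_integer_of_forall_inertia`,
`artinIdeleMap_localUnits_eq_absRestrictNormalHom`) fed to `det_eq_of_forall_artinIdeleMap_eq` through a
representative of `[x, K]` (`abRestrict_ideleArtinMap`: `[x, K]|_L = ψ_{L|K}(x)`).
[cite: NeukirchANT1999, Ch. VI §6 Thm. (6.1), §5 Prop. (5.6)] [cite: SerreAbelianLadic1968, Ch. III §2.1–2.3] -/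
theorem FramedGaloisRep.exists_idelicCharacter_global (ψ : FramedGaloisRep K A 1) :
    ∃ Ψ : ideleGroup K →ₜ* Aˣ,
      (∀ x ∈ principalIdeles K, Ψ x = 1) ∧
      (∀ v : HeightOneSpectrum (𝓞 K), ψ.IsUnramifiedAt v →
        (∀ u : (v.adicCompletionIntegers K)ˣ,
            Ψ (localUnits v (Units.map ((v.adicCompletionIntegers K).subtype : _ →* _) u)) = 1) ∧
        ∀ ϖ : (v.adicCompletion K)ˣ,
          Valued.v (ϖ : v.adicCompletion K) = WithZero.exp (-1 : ℤ) →
            ψ.HasFrobCharpolyAt v (X - C ((Ψ (localUnits v ϖ) : Aˣ) : A))) ∧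
      ∀ (σ : absoluteGaloisGroup K) (x : ideleGroup K),
        absGaloisAbProj K σ = ideleArtinMap K x → Ψ x = FramedRep.det ψ σ := by
  classical
  set hR : artinReciprocity_character := artinReciprocity_character_holds with hRdef
  set χ : absoluteGaloisGroup K →ₜ* Aˣ := FramedRep.det ψ with hχdef
  -- `χ` factors through `Γ_K^ab = Γ_K ⧸ closure [Γ_K, Γ_K]`
  have hC : (commutator (absoluteGaloisGroup K)).topologicalClosure ≤ χ.toMonoidHom.ker := by
    refine Subgroup.topologicalClosure_minimal _ (Abelianization.commutator_subset_ker _) ?_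
    rw [MonoidHom.coe_ker]
    exact isClosed_singleton.preimage χ.continuous
  set χab : absoluteGaloisGroupAbelianization K →* Aˣ :=
    QuotientGroup.lift (commutator (absoluteGaloisGroup K)).topologicalClosure χ.toMonoidHom hC
    with hχabdef
  have hχab : ∀ γ : absoluteGaloisGroup K, χab (absGaloisAbProj K γ) = χ γ := fun γ => rfl
  have hχabc : Continuous χab := by
    rw [(QuotientGroup.isQuotientMap_mk
      (commutator (absoluteGaloisGroup K)).topologicalClosure).continuous_iff]
    exact χ.continuous
  -- the character `Ψ := χ^ab ∘ [·, K]`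
  set Ψ : ideleGroup K →ₜ* Aˣ :=
    ⟨χab.comp (ideleArtinMap K), hχabc.comp (continuous_ideleArtinMap K)⟩ with hΨdef
  have hΨapply : ∀ x : ideleGroup K, Ψ x = χab (ideleArtinMap K x) := fun x => rfl
  -- the global clause
  have hglob : ∀ (σ : absoluteGaloisGroup K) (x : ideleGroup K),
      absGaloisAbProj K σ = ideleArtinMap K x → Ψ x = χ σ := fun σ x h => by
    rw [hΨapply, ← h, hχab]
  -- evaluation through representatives of `[x, K]` in the compatible system of Artin maps
  have hΨrep : ∀ x : ideleGroup K, ∃ γ : absoluteGaloisGroup K,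
      Ψ x = χ γ ∧ γ ∈ (isCompatibleSystem_artinMapFamily (K := K) hR).Reps (QuotientGroup.mk x) :=
    fun x => by
    obtain ⟨γ, hγ⟩ := QuotientGroup.mk_surjective (ideleArtinMap K x)
    refine ⟨γ, hglob γ x hγ, ?_⟩
    rw [ideleArtinMap_apply] at hγ
    exact ((isGlobalReciprocitySystem_artinMap K).toIsCompatibleSystem.absGaloisAbProj_eq_theta_iff).mp
      hγ
  refine ⟨Ψ, fun x hx => ?_, fun v hv => ?_, hglob⟩
  · rw [hΨapply, ideleArtinMap_eq_one_of_mem_principalIdeles hx, map_one]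
  · -- at `v` unramified for `ψ`, all inertia above `v` dies wherever `ker ψ` does
    have hI : ∀ (L : IntermediateField K (AlgebraicClosure K)) [FiniteDimensional K L]
        [IsAbelianGalois K L],
        (∀ σ : absoluteGaloisGroup K, ψ σ = 1 → absRestrictNormalHom L σ = 1) →
        ∀ 𝔓 ∈ v.primesAbove, ∀ σ ∈ 𝔓.inertia (absoluteGaloisGroup K),
          absRestrictNormalHom L σ = 1 :=
      fun L _ _ hL 𝔓 h𝔓 σ hσ => hL σ (hv 𝔓 h𝔓 σ hσ)
    refine ⟨fun u => ?_, fun ϖ hϖ => ?_⟩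
    · obtain ⟨γ, hΨγ, hγr⟩ :=
        hΨrep (localUnits v (Units.map ((v.adicCompletionIntegers K).subtype : _ →* _) u))
      have h1 : χ γ = χ 1 :=
        FramedGaloisRep.det_eq_of_forall_artinIdeleMap_eq hR ψ hγr fun L _ _ _ hL => by
          rw [map_one]
          exact artinIdeleMap_localUnits_integer_of_forall_inertia L hR (hI L hL) u
      rw [hΨγ, h1, map_one]
    · obtain ⟨γ, hΨγ, hγr⟩ := hΨrep (localUnits v ϖ)
      refine (FramedGaloisRep.hasFrobCharpolyAt_iff_of_rank_one ψ v _).mpr fun 𝔓 h𝔓 Φ hΦ => ?_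
      have h1 : χ γ = χ Φ :=
        FramedGaloisRep.det_eq_of_forall_artinIdeleMap_eq hR ψ hγr fun L _ _ _ hL =>
          artinIdeleMap_localUnits_eq_absRestrictNormalHom L hR (hI L hL) hϖ h𝔓 hΦ
      rw [hΨγ, h1, hχdef, FramedGaloisRep.coe_det_apply_of_rank_one]

/-- Every `σ ∈ Γ_K` is reached: there is an idele `x` with `σ|_{K^ab} = [x, K]` (`[·, K]` is onto
`Gal(K^ab/K)`). [cite: NeukirchANT1999, Ch. VI §6 Thm. (6.1)] -/
theorem exists_absGaloisAbProj_eq_ideleArtinMap (σ : absoluteGaloisGroup K) :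
    ∃ x : ideleGroup K, absGaloisAbProj K σ = ideleArtinMap K x := by
  obtain ⟨x, hx⟩ := ideleArtinMap_surjective K (absGaloisAbProj K σ)
  exact ⟨x, hx.symm⟩

/-! ### §2. Weil's avatar at a global element -/

namespace HeckeCharacter

variable {ℓ : ℕ} [Fact ℓ.Prime] {χ : HeckeCharacter K} {p q : InfinitePlace K → ℤ}
  {T : Finset (HeightOneSpectrum (𝓞 K))} {e : HeightOneSpectrum (𝓞 K) → ℕ}

/-- **Weil's avatar at a GLOBAL element: `det r(σ) = ψ_ℓ(x)⁻¹` whenever `σ|_{K^ab} = [x, K]`**, for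
`r = hinf.weilRep hmod ι` the `ℓ`-adic avatar of a Hecke character `χ` of infinity type `(p, q)`
unramified outside `T`, and `ψ_ℓ = hinf.lAdicAvatar ι` its avatar on ideles: the idelic character of
`r` with the global clause (§1) is `ψ_ℓ⁻¹` (`eq_lAdicAvatar_inv`).
[cite: SerreAbelianLadic1968, Ch. II §2.7, Ch. III §2.3] [cite: Weil1956, §1–§2] -/
theorem HasInfinityType.det_weilRep_eq_lAdicAvatar_inv (hinf : χ.HasInfinityType p q)
    (hmod : IsModulus χ T e) (ι : PadicAlgCl ℓ ≃+* ℂ) (hT : ∀ w, w ∉ T → χ.IsUnramifiedAt w)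
    {σ : absoluteGaloisGroup K} {x : ideleGroup K} (hσ : absGaloisAbProj K σ = ideleArtinMap K x) :
    FramedRep.det (hinf.weilRep hmod ι) σ = ((hinf.lAdicAvatar ι) x)⁻¹ := by
  obtain ⟨Ψ, hΨK, hΨunr, hglob⟩ :=
    FramedGaloisRep.exists_idelicCharacter_global (hinf.weilRep hmod ι)
  have hΨ := hinf.eq_lAdicAvatar_inv hmod ι hT hΨK hΨunr
  have h := hglob σ x hσ
  rw [hΨ, cmh_inv_apply''] at h
  exact h.symm

/-- The same, read in `ℚ̄_ℓ`: the `(0,0)` entry of `r(σ)` is `(ψ_ℓ(x) : ℚ̄_ℓ)⁻¹`.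
[cite: SerreAbelianLadic1968, Ch. II §2.7] -/
theorem HasInfinityType.weilRep_apply_eq_lAdicAvatarHom_inv (hinf : χ.HasInfinityType p q)
    (hmod : IsModulus χ T e) (ι : PadicAlgCl ℓ ≃+* ℂ) (hT : ∀ w, w ∉ T → χ.IsUnramifiedAt w)
    {σ : absoluteGaloisGroup K} {x : ideleGroup K} (hσ : absGaloisAbProj K σ = ideleArtinMap K x) :
    ((hinf.weilRep hmod ι σ : GL (Fin 1) (PadicAlgCl ℓ)) : Matrix (Fin 1) (Fin 1) (PadicAlgCl ℓ)) 0 0 =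
      ((lAdicAvatarHom χ ι p q x : (PadicAlgCl ℓ)ˣ) : PadicAlgCl ℓ)⁻¹ := by
  rw [← FramedGaloisRep.coe_det_apply_of_rank_one, hinf.det_weilRep_eq_lAdicAvatar_inv hmod ι hT hσ,
    Units.val_inv_eq_inv_val, hinf.lAdicAvatar_apply]

end HeckeCharacter

end Literature.NumberTheory.GaloisRepresentations

/-! ### §3. ANY avatar of an algebraic Hecke character at a global element -/

namespace Literature.NumberTheory.EllipticCurves

open Literature.NumberTheory.GaloisRepresentations Literature.NumberTheory.NumberFields

variable {p : ℕ} [Fact p.Prime] {K : Type} [Field K] [NumberField K]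

/-- **An avatar in the tree's Frobenius sense IS Weil's avatar**: if `r` is a `p`-adic avatar of `φ`
(`IsPAdicAvatarOf ι φ r`) and `φ` has infinity type `(pp, qq)`, then `r = hinf.weilRep hmod ι` for the
modulus `hmod` supported on the ramified places of `φ` — both are avatars outside `∅`, and avatars are
unique (`IsPAdicAvatarOutside.eq_of_isPAdicAvatarOf`, Chebotarev).
[cite: SerreAbelianLadic1968, Ch. I §2.3, Ch. II §2.7] [cite: Weil1956, §1–§2] -/
theorem IsPAdicAvatarOf.eq_weilRep {φ : HeckeCharacter K} {pp qq : InfinitePlace K → ℤ}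
    (hinf : φ.HasInfinityType pp qq) (ι : PadicAlgCl p ≃+* ℂ) {r : FramedGaloisRep K (PadicAlgCl p) 1}
    (hav : IsPAdicAvatarOf ι φ r) {e : HeightOneSpectrum (𝓞 K) → ℕ}
    (hmod : HeckeCharacter.IsModulus φ (HeckeCharacter.finite_ramifiedPlaces_holds φ).toFinset e) :
    r = hinf.weilRep hmod ι := by
  have hav₀ : IsPAdicAvatarOf ι φ (hinf.weilRep hmod ι) := fun v hvℓ hv ↦ by
    have hvT : v ∉ (HeckeCharacter.finite_ramifiedPlaces_holds φ).toFinset := fun h ↦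
      ((HeckeCharacter.finite_ramifiedPlaces_holds φ).mem_toFinset.mp h) hv
    refine ⟨hinf.isUnramifiedAt_weilRep hmod ι hvT hvℓ, ?_⟩
    have h := hinf.hasFrobCharpolyAt_weilRep hmod ι hvT hvℓ
    rwa [map_inv₀] at h
  exact (hav.isPAdicAvatarOutside ∅).eq_of_isPAdicAvatarOf hav₀

/-- ★ **ANY avatar at a GLOBAL element: `det r(σ) = ψ_p(x)⁻¹` whenever `σ|_{K^ab} = [x, K]`.** For a
Hecke character `φ` of infinity type `(pp, qq)`, any `p`-adic avatar `r` of `φ` (`IsPAdicAvatarOf ι φ r`),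
and `σ ∈ Γ_K`, `x ∈ 𝕀_K` with `absGaloisAbProj K σ = ideleArtinMap K x`:
`det r σ = (lAdicAvatarHom φ ι pp qq x)⁻¹` — `r` is Weil's avatar (`eq_weilRep`) and §2.
[cite: SerreAbelianLadic1968, Ch. II §2.7, Ch. III §2.3] [cite: deShalit1987, II.4.13 (p. 69)] -/
theorem IsPAdicAvatarOf.det_eq_lAdicAvatarHom_inv {φ : HeckeCharacter K} {pp qq : InfinitePlace K → ℤ}
    (hinf : φ.HasInfinityType pp qq) (ι : PadicAlgCl p ≃+* ℂ) {r : FramedGaloisRep K (PadicAlgCl p) 1}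
    (hav : IsPAdicAvatarOf ι φ r) {σ : absoluteGaloisGroup K} {x : ideleGroup K}
    (hσ : absGaloisAbProj K σ = ideleArtinMap K x) :
    FramedRep.det r σ = (HeckeCharacter.lAdicAvatarHom φ ι pp qq x)⁻¹ := by
  obtain ⟨e, hmod⟩ := φ.exists_isModulus_of_ramified
  have hT : ∀ w, w ∉ (HeckeCharacter.finite_ramifiedPlaces_holds φ).toFinset → φ.IsUnramifiedAt w :=
    fun w hw ↦ by
      by_contra h
      exact hw ((HeckeCharacter.finite_ramifiedPlaces_holds φ).mem_toFinset.mpr h)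
  rw [hav.eq_weilRep hinf ι hmod, hinf.det_weilRep_eq_lAdicAvatar_inv hmod ι hT hσ,
    hinf.lAdicAvatar_apply]

/-- ★ **The value `φ̂(σ) ∈ ℂ_p` of ANY avatar at a GLOBAL element**: with the hypotheses of
`det_eq_lAdicAvatarHom_inv`, `avatarValueAt r σ = ((lAdicAvatarHom φ ι pp qq x)⁻¹ : ℚ̄_p)`, where
`lAdicAvatarHom φ ι pp qq x = ι⁻¹(φ(x)·A_{pp,qq}(x_∞)⁻¹) · ∏_{(w,e) : w ∣ p} e(x_w)^{−n_{(w,e)}}`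
(`HeckeCharacter.coe_lAdicAvatarHom_apply`) — the integrand of de Shalit's (49)–(50) on `Γ_K`, read
on ideles. [cite: deShalit1987, II.4.13 (p. 69), II.4.16 (49) (p. 76)] [cite: SerreAbelianLadic1968, Ch. II §2.7] -/
theorem IsPAdicAvatarOf.avatarValueAt_eq {φ : HeckeCharacter K} {pp qq : InfinitePlace K → ℤ}
    (hinf : φ.HasInfinityType pp qq) (ι : PadicAlgCl p ≃+* ℂ) {r : FramedGaloisRep K (PadicAlgCl p) 1}
    (hav : IsPAdicAvatarOf ι φ r) {σ : absoluteGaloisGroup K} {x : ideleGroup K}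
    (hσ : absGaloisAbProj K σ = ideleArtinMap K x) :
    avatarValueAt r σ =
      ((((HeckeCharacter.lAdicAvatarHom φ ι pp qq x)⁻¹ : (PadicAlgCl p)ˣ) : PadicAlgCl p) : ℂ_[p]) := by
  have h := hav.det_eq_lAdicAvatarHom_inv hinf ι hσ
  rw [FramedRep.det] at h
  unfold avatarValueAt
  exact congrArg (fun u : (PadicAlgCl p)ˣ ↦ ((u : PadicAlgCl p) : ℂ_[p])) h

end Literature.NumberTheory.EllipticCurves

end
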